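import Literature.Probability.Percolation.PassengerLonelyExchange
import HarnessLib

/-!
# Lonely-cluster transfer with a monotone rider; passenger dominance through a vertex SET

Topic `Literature/Probability/Percolation`.  Bond percolation `μ = prodBernoulli w` on a finite vertex type, relays `A`,
level `j`; `π(v) = A.filter (v ↔ ·)`, `R_v = {|π(v)| ≤ j}` ("`v` is lonely"), `D = {s ↮ t}`.

Van den Berg–Häggström–Kahn's Theorem 1.5 ([VandenbergHaggstromKahn2005, Thm. 1.5 p. 7]; tree: `twoClusterExchange`) makes
the events of type `(+)` on `D` (closed under enlarging `C_s` and shrinking `C_t`) pairwise positively correlated and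
negatively correlated with the type `(−)` events.  The tree's `passengerLonelyTransfer` rides the comparison
`μ(D ∩ R_s) ≤ μ(D ∩ R_t)` with the passenger event `{s ↔ x}`.  Here:

* `lonelyTransfer_of_typePlus` — the same transfer for an ARBITRARY type-`(+)` rider `P`:
  `μ(D ∩ (R_s ∩ R_tᶜ ∩ P)) ≤ μ(D ∩ (R_t ∩ R_sᶜ ∩ P))`.
* `real_inter_lonely_le_of_le` — the hypothesis `μ(D ∩ R_s) ≤ μ(D ∩ R_t)` from the unconditional `μ(R_s) ≤ μ(R_t)` (on `{s ↔ t}`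
  the two loneliness events coincide).
* `setPassengerLonelyTransfer` — the rider `P = {s ↔ U} ∩ {t ↮ U}` for a finite vertex set `U`
  (`{s ↔ U} = ⋃_{y ∈ U} {s ↔ y}`, `{t ↮ U} = ⋂_{y ∈ U} {t ↮ y}`), under `μ(R_s) ≤ μ(R_t)`:
  `μ(s ↮ t, s ↔ U, t ↮ U, R_s, ¬R_t) ≤ μ(s ↮ t, s ↔ U, t ↮ U, R_t, ¬R_s)`.
  Read in the graph with `U` glued into one vertex `u`, this says: given `u ↮ t` and `s` riding with `u`, "`s` lonely, `t`
  crowded" is no likelier than "`t` lonely, `s` crowded" — with the loneliness comparison taken in the UNGLUED graph.  It is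
  the exchange step of the coin reduction of the pattern-lightest bound (`NoHeavyLowerTail` line, stmt-CriticalPhenomena-4575).

No definition and no named fact is introduced.
-/

noncomputable section

open MeasureTheory Set
open Literature.Probability.LatticeModels (prodBernoulli)
open scoped Classical

namespace Literature.Probability.Percolation

variable {V : Type*}

open TwoClusterExchange LonelyClusterExchange in
/-- **Lonely transfer with a type-`(+)` rider.**  For `s ≠ t`, relays `A`, level `j`, `D = {s ↮ t}`, `R_v = {|π(v)| ≤ j}`, and
any event `P` closed under (enlarging `C_s`, shrinking `C_t`): if `μ(D ∩ R_s) ≤ μ(D ∩ R_t)` then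
`μ(D ∩ (R_s ∩ R_tᶜ ∩ P)) ≤ μ(D ∩ (R_t ∩ R_sᶜ ∩ P))`.
[cite: VandenbergHaggstromKahn2005, Thm. 1.5 (p. 7) — corollary via `twoClusterExchange`] -/
theorem lonelyTransfer_of_typePlus [Fintype V] (w : Sym2 V → unitInterval) (A : Finset V) (j : ℕ)
    {s t : V} (hst : s ≠ t) {P : Set (BondConfig V)}
    (hP : ∀ ⦃ω ω' : BondConfig V⦄, openEdgeCluster ω s ⊆ openEdgeCluster ω' s →
      openEdgeCluster ω' t ⊆ openEdgeCluster ω t → ω ∈ P → ω' ∈ P)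
    (h : (prodBernoulli w).real ((openConn s t)ᶜ ∩
        {ω : BondConfig V | (A.filter fun z => ω ∈ openConn s z).card ≤ j}) ≤
      (prodBernoulli w).real ((openConn s t)ᶜ ∩
        {ω : BondConfig V | (A.filter fun z => ω ∈ openConn t z).card ≤ j})) :
    (prodBernoulli w).real ((openConn s t)ᶜ ∩
        ({ω : BondConfig V | (A.filter fun z => ω ∈ openConn s z).card ≤ j} ∩
          {ω : BondConfig V | (A.filter fun z => ω ∈ openConn t z).card ≤ j}ᶜ ∩ P)) ≤
      (prodBernoulli w).real ((openConn s t)ᶜ ∩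
        ({ω : BondConfig V | (A.filter fun z => ω ∈ openConn t z).card ≤ j} ∩
          {ω : BondConfig V | (A.filter fun z => ω ∈ openConn s z).card ≤ j}ᶜ ∩ P)) := by
  set μ := prodBernoulli w with hμ
  set D : Set (BondConfig V) := (openConn s t)ᶜ with hD
  set Rs : Set (BondConfig V) := {ω | (A.filter fun z => ω ∈ openConn s z).card ≤ j} with hRs
  set Rt : Set (BondConfig V) := {ω | (A.filter fun z => ω ∈ openConn t z).card ≤ j} with hRt
  have hmeas : ∀ S : Set (BondConfig V), MeasurableSet S := fun S => (Set.toFinite S).measurableSet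
  have hRtp : ∀ ⦃ω ω' : BondConfig V⦄, openEdgeCluster ω s ⊆ openEdgeCluster ω' s →
      openEdgeCluster ω' t ⊆ openEdgeCluster ω t → ω ∈ Rt → ω' ∈ Rt :=
    fun ω ω' h1 h2 hω => typePlus_card_le A j s t h1 h2 hω
  have hRsm : ∀ ⦃ω ω' : BondConfig V⦄, openEdgeCluster ω' s ⊆ openEdgeCluster ω s →
      openEdgeCluster ω t ⊆ openEdgeCluster ω' t → ω ∈ Rs → ω' ∈ Rs :=
    fun ω ω' h1 h2 hω => typeMinus_card_le A j s t h1 h2 hω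
  have hAm : ∀ ⦃ω ω' : BondConfig V⦄, openEdgeCluster ω' s ⊆ openEdgeCluster ω s →
      openEdgeCluster ω t ⊆ openEdgeCluster ω' t → ω ∈ Rs ∩ Rtᶜ → ω' ∈ Rs ∩ Rtᶜ := by
    intro ω ω' h1 h2 hω
    exact ⟨hRsm h1 h2 hω.1, fun h' => hω.2 (hRtp h1 h2 h')⟩
  have huniv_p : ∀ ⦃ω ω' : BondConfig V⦄, openEdgeCluster ω s ⊆ openEdgeCluster ω' s →
      openEdgeCluster ω' t ⊆ openEdgeCluster ω t → ω ∈ (univ : Set (BondConfig V)) → ω' ∈ (univ : Set _) :=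
    fun _ _ _ _ _ => mem_univ _
  have huniv_m : ∀ ⦃ω ω' : BondConfig V⦄, openEdgeCluster ω' s ⊆ openEdgeCluster ω s →
      openEdgeCluster ω t ⊆ openEdgeCluster ω' t → ω ∈ (univ : Set (BondConfig V)) → ω' ∈ (univ : Set _) :=
    fun _ _ _ _ _ => mem_univ _
  -- step 1: negative correlation of P (+) with Rs ∩ Rtᶜ (−) given D
  have step1 := twoClusterExchange w hst (A₁ := P) (A₂ := univ) (B₁ := Rs ∩ Rtᶜ) (B₂ := univ)
    hP huniv_p hAm huniv_m
  simp only [inter_univ] at step1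
  -- step 2: the hypothesis without the common part
  have step2 : μ.real (D ∩ (Rs ∩ Rtᶜ)) ≤ μ.real (D ∩ (Rt ∩ Rsᶜ)) := by
    have e1 : μ.real (D ∩ Rs) = μ.real (D ∩ (Rs ∩ Rt)) + μ.real (D ∩ (Rs ∩ Rtᶜ)) := by
      rw [← measureReal_inter_add_sdiff (s := D ∩ Rs) (hmeas Rt)]
      congr 1
      · congr 1; ext ω; simp only [mem_inter_iff]; tauto
      · congr 1; ext ω; simp only [mem_inter_iff, mem_sdiff, mem_compl_iff]; tauto
    have e2 : μ.real (D ∩ Rt) = μ.real (D ∩ (Rs ∩ Rt)) + μ.real (D ∩ (Rt ∩ Rsᶜ)) := by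
      rw [← measureReal_inter_add_sdiff (s := D ∩ Rt) (hmeas Rs)]
      congr 1
      · congr 1; ext ω; simp only [mem_inter_iff]; tauto
      · congr 1; ext ω; simp only [mem_inter_iff, mem_sdiff, mem_compl_iff]; tauto
    have := h
    rw [e1, e2] at this
    linarith
  -- rewrite the goal sets
  have eL : D ∩ (Rs ∩ Rtᶜ ∩ P) = D ∩ (P ∩ (Rs ∩ Rtᶜ)) := by
    ext ω; simp only [mem_inter_iff, mem_compl_iff]; tauto
  rw [eL]
  by_cases hD0 : μ.real D = 0
  · have h0 : μ.real (D ∩ (P ∩ (Rs ∩ Rtᶜ))) ≤ μ.real D :=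
      measureReal_mono inter_subset_left (measure_ne_top _ _)
    rw [hD0] at h0
    exact h0.trans measureReal_nonneg
  · have hDpos : 0 < μ.real D := lt_of_le_of_ne measureReal_nonneg (Ne.symm hD0)
    have hE0 : 0 ≤ μ.real (D ∩ P) := measureReal_nonneg
    have c1 : μ.real (D ∩ (P ∩ (Rs ∩ Rtᶜ))) * μ.real D ≤ μ.real (D ∩ P) * μ.real (D ∩ (Rs ∩ Rtᶜ)) := step1
    have c2 : μ.real (D ∩ P) * μ.real (D ∩ (Rs ∩ Rtᶜ)) ≤ μ.real (D ∩ P) * μ.real (D ∩ (Rt ∩ Rsᶜ)) :=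
      mul_le_mul_of_nonneg_left step2 hE0
    -- μ(D ∩ (Rt ∩ Rsᶜ)) · μ(D ∩ P) ≤ μ(D ∩ (Rt ∩ Rsᶜ ∩ P)) · μ(D): positive correlation of two (+) events
    have hBp' : ∀ ⦃ω ω' : BondConfig V⦄, openEdgeCluster ω s ⊆ openEdgeCluster ω' s →
        openEdgeCluster ω' t ⊆ openEdgeCluster ω t → ω ∈ Rt ∩ Rsᶜ → ω' ∈ Rt ∩ Rsᶜ := by
      intro ω ω' h1 h2 hω
      exact ⟨hRtp h1 h2 hω.1, fun h' => hω.2 (hRsm h1 h2 h')⟩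
    have step3' := twoClusterExchange w hst (A₁ := Rt ∩ Rsᶜ) (A₂ := P) (B₁ := univ) (B₂ := univ)
      hBp' hP huniv_m huniv_m
    simp only [inter_univ] at step3'
    have c3 : μ.real (D ∩ (Rt ∩ Rsᶜ)) * μ.real (D ∩ P) ≤ μ.real (D ∩ (Rt ∩ Rsᶜ ∩ P)) * μ.real D := step3'
    have c4 : μ.real (D ∩ (P ∩ (Rs ∩ Rtᶜ))) * μ.real D ≤ μ.real (D ∩ (Rt ∩ Rsᶜ ∩ P)) * μ.real D := by
      calc μ.real (D ∩ (P ∩ (Rs ∩ Rtᶜ))) * μ.real D ≤ μ.real (D ∩ P) * μ.real (D ∩ (Rs ∩ Rtᶜ)) := c1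
        _ ≤ μ.real (D ∩ P) * μ.real (D ∩ (Rt ∩ Rsᶜ)) := c2
        _ = μ.real (D ∩ (Rt ∩ Rsᶜ)) * μ.real (D ∩ P) := mul_comm _ _
        _ ≤ μ.real (D ∩ (Rt ∩ Rsᶜ ∩ P)) * μ.real D := c3
    exact le_of_mul_le_mul_right c4 hDpos

/-- On `{s ↔ t}` the loneliness events of `s` and `t` coincide, so `μ(R_s) ≤ μ(R_t)` implies
`μ({s ↮ t} ∩ R_s) ≤ μ({s ↮ t} ∩ R_t)`. [folklore] -/
theorem real_inter_lonely_le_of_le [Fintype V] (w : Sym2 V → unitInterval) (A : Finset V) (j : ℕ) (s t : V)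
    (hle : (prodBernoulli w).real {ω : BondConfig V | (A.filter fun z => ω ∈ openConn s z).card ≤ j} ≤
      (prodBernoulli w).real {ω : BondConfig V | (A.filter fun z => ω ∈ openConn t z).card ≤ j}) :
    (prodBernoulli w).real ((openConn s t)ᶜ ∩
        {ω : BondConfig V | (A.filter fun z => ω ∈ openConn s z).card ≤ j}) ≤
      (prodBernoulli w).real ((openConn s t)ᶜ ∩
        {ω : BondConfig V | (A.filter fun z => ω ∈ openConn t z).card ≤ j}) := by
  set μ := prodBernoulli w with hμ
  set D : Set (BondConfig V) := (openConn s t)ᶜ with hD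
  set Rs : Set (BondConfig V) := {ω | (A.filter fun z => ω ∈ openConn s z).card ≤ j} with hRs
  set Rt : Set (BondConfig V) := {ω | (A.filter fun z => ω ∈ openConn t z).card ≤ j} with hRt
  have hmeas : ∀ S : Set (BondConfig V), MeasurableSet S := fun S => (Set.toFinite S).measurableSet
  -- on Dᶜ = {s ↔ t} the filters coincide
  have hco : Dᶜ ∩ Rs = Dᶜ ∩ Rt := by
    ext ω
    simp only [hD, compl_compl, mem_inter_iff, hRs, hRt, mem_setOf_eq]
    constructor
    · rintro ⟨hst, h⟩
      refine ⟨hst, ?_⟩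
      have heq : (A.filter fun z => ω ∈ openConn s z) = A.filter fun z => ω ∈ openConn t z := by
        apply Finset.filter_congr
        intro z _
        have hst' : (openGraph ω).Reachable s t := hst
        exact ⟨fun h' => (hst'.symm.trans h' : (openGraph ω).Reachable t z),
          fun h' => (hst'.trans h' : (openGraph ω).Reachable s z)⟩
      rw [← heq]; exact h
    · rintro ⟨hst, h⟩
      refine ⟨hst, ?_⟩
      have heq : (A.filter fun z => ω ∈ openConn s z) = A.filter fun z => ω ∈ openConn t z := by
        apply Finset.filter_congr
        intro z _
        have hst' : (openGraph ω).Reachable s t := hst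
        exact ⟨fun h' => (hst'.symm.trans h' : (openGraph ω).Reachable t z),
          fun h' => (hst'.trans h' : (openGraph ω).Reachable s z)⟩
      rw [heq]; exact h
  have e1 : μ.real Rs = μ.real (Rs ∩ D) + μ.real (Rs \ D) := (measureReal_inter_add_sdiff (hmeas D)).symm
  have e2 : μ.real Rt = μ.real (Rt ∩ D) + μ.real (Rt \ D) := (measureReal_inter_add_sdiff (hmeas D)).symm
  have e3 : Rs \ D = Dᶜ ∩ Rs := by ext ω; simp only [mem_sdiff, mem_inter_iff, mem_compl_iff]; tauto
  have e4 : Rt \ D = Dᶜ ∩ Rt := by ext ω; simp only [mem_sdiff, mem_inter_iff, mem_compl_iff]; tauto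
  rw [e3] at e1
  rw [e4, ← hco] at e2
  rw [inter_comm D Rs, inter_comm D Rt]
  linarith

/-- `{s ↔ U} ∩ {t ↮ U}` is of type `(+)` for the pair `(s, t)`: it is closed under enlarging `C_s` and shrinking `C_t`.
[folklore] -/
theorem typePlus_conn_set_inter_not_conn_set (s t : V) (U : Finset V) ⦃ω ω' : BondConfig V⦄
    (h1 : openEdgeCluster ω s ⊆ openEdgeCluster ω' s) (h2 : openEdgeCluster ω' t ⊆ openEdgeCluster ω t)
    (hω : ω ∈ (⋃ y ∈ U, (openConn s y : Set (BondConfig V))) ∩ ⋂ y ∈ U, (openConn t y : Set (BondConfig V))ᶜ) :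
    ω' ∈ (⋃ y ∈ U, (openConn s y : Set (BondConfig V))) ∩ ⋂ y ∈ U, (openConn t y : Set (BondConfig V))ᶜ := by
  obtain ⟨hU, hI⟩ := hω
  rw [mem_iUnion₂] at hU
  obtain ⟨y, hy, hsy⟩ := hU
  refine ⟨mem_iUnion₂.2 ⟨y, hy, typePlus_openConn s t y h1 h2 hsy⟩, ?_⟩
  rw [mem_iInter₂] at hI ⊢
  intro z hz
  exact typePlus_not_openConn s t z h1 h2 (hI z hz)

/-- **Passenger dominance through a vertex set.**  For `s ≠ t`, a finite vertex set `U`, relays `A`, level `j`, with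
`μ(R_s) ≤ μ(R_t)` (`R_v = {|π(v)| ≤ j}`):
`μ(s ↮ t, s ↔ U, t ↮ U, R_s, ¬R_t) ≤ μ(s ↮ t, s ↔ U, t ↮ U, R_t, ¬R_s)`, where `{s ↔ U} = ⋃_{y∈U} {s ↔ y}` and
`{t ↮ U} = ⋂_{y∈U} {t ↮ y}`.  In the graph with `U` glued to a point `u` this reads: given `u ↮ t` and `s ↔ u`, the event
"`s` lonely, `t` crowded" is no likelier than "`t` lonely, `s` crowded", the comparison `μ(R_s) ≤ μ(R_t)` being taken in the
UNGLUED graph. [cite: VandenbergHaggstromKahn2005, Thm. 1.5 (p. 7) — corollary via `twoClusterExchange`] -/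
theorem setPassengerLonelyTransfer [Fintype V] (w : Sym2 V → unitInterval) (A : Finset V) (j : ℕ)
    {s t : V} (hst : s ≠ t) (U : Finset V)
    (hle : (prodBernoulli w).real {ω : BondConfig V | (A.filter fun z => ω ∈ openConn s z).card ≤ j} ≤
      (prodBernoulli w).real {ω : BondConfig V | (A.filter fun z => ω ∈ openConn t z).card ≤ j}) :
    (prodBernoulli w).real ((openConn s t)ᶜ ∩
        ({ω : BondConfig V | (A.filter fun z => ω ∈ openConn s z).card ≤ j} ∩
          {ω : BondConfig V | (A.filter fun z => ω ∈ openConn t z).card ≤ j}ᶜ ∩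
          ((⋃ y ∈ U, (openConn s y : Set (BondConfig V))) ∩ ⋂ y ∈ U, (openConn t y : Set (BondConfig V))ᶜ))) ≤
      (prodBernoulli w).real ((openConn s t)ᶜ ∩
        ({ω : BondConfig V | (A.filter fun z => ω ∈ openConn t z).card ≤ j} ∩
          {ω : BondConfig V | (A.filter fun z => ω ∈ openConn s z).card ≤ j}ᶜ ∩
          ((⋃ y ∈ U, (openConn s y : Set (BondConfig V))) ∩ ⋂ y ∈ U, (openConn t y : Set (BondConfig V))ᶜ))) :=
  lonelyTransfer_of_typePlus w A j hst (fun _ _ h1 h2 hω => typePlus_conn_set_inter_not_conn_set s t U h1 h2 hω)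
    (real_inter_lonely_le_of_le w A j s t hle)

end Literature.Probability.Percolation

end
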